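/-
Copyright (c) 2026 the pub-hodgecm-mathlib formalisation cell (harness21).  Prover seat hodgecm-mathlib-K2E1-p09 (g5), Track B ∕ K2-LIT,
h413 = `stmt-HodgeConjecture-24833`, line `K2_E1_TraceFormulaBeta`, campaign «EIS-RANK-ONE»; deal «MS-PAIR-2» (i) «CM-FINAL-2» of the dealer K2E1-plan (g4) 2026-09-04T06:39:24Z,
edition (b): `hΛbdd` ∕ `hdec′` discharged by ★ p857911 B′ (this seat) for a GENERAL level-`U₀` coefficient `φ′` with the archimedean binder `hφ′arch`.
-/
import Summits.HodgeConjecture.HodgeConjecture.Theorems.K2E1MaassSelbergCMTwoFinal     -- ★ p858104 (this seat): §1 `maassSelberg_flatSectionU_cm_two_final`; imports ★ p857911 B′ via ★ p858035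
import HarnessLib

/-!
# K2·E1 — `K2E1MaassSelbergCMTwoFinalArch`: THE MAASS–SELBERG RELATION FOR FLAT SECTIONS OF `U(J₂)` AT THE CM PAIR, `hdec′` DISCHARGED BY ★ p857911 B′ FROM `hφ′arch`
# («EIS-RANK-ONE», «MS-PAIR-2» (i), edition (b): the dealer's «your ★ p857911∕(R3u) for `hΛbdd`» for a general finite-level coefficient `φ′`)

Track B ∕ K2-LIT, crux h413 = `stmt-HodgeConjecture-24833`, route of record `HCCMUnconditional`; cell `hodgecm-mathlib`, squad K2, ENGINE E1.  Prover seat `hodgecm-mathlib-K2E1-p09` (g5).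
THEOREMS ONLY (no `def`, no `instance`, no notation, no named-fact hypothesis, no `sorry`); lane `--kind proof --supports stmt-HodgeConjecture-24833 --as helper` (count-neutral).
Closes no socket.

THE MATHEMATICS [MoeglinWaldspurger1995, I.2.10–I.2.13, II.1.7, IV.2; Garrett2018, §2.9–§2.11, §11.3].  ★ p858104 §1 `maassSelberg_flatSectionU_cm_two_final` names the decay `hdec′ :
‖E(f′_{z′})(g) − E(f′_{z′})_B(g)‖ ≤ M₁` on `{H > T}`.  ★ p857911 edition B′ `exists_bound_sub_borelConstantTerm_level_cm_two_of_archSmooth` (this seat) PROVES it from: the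
modularity `hf′` of `f′_{z′} = φ′·H^{z′}` under `B(𝔸)` for a unitary Hecke character `χ` (constant term along `N`, ★ p857628), an open finite level `U₀ ≤ GL₂(𝒪̂_L)` fixing `φ′` on the
right (uniform lattice `𝔫𝒪̂` along the big-cell line, ★ p857884), `m > [L⁺:ℚ]`, and the archimedean binder `hφ′arch`: `C^m`-smoothness of `a ↦ f′_{z′}(ι(w₀)·n(θ(a,b))·k)` on
`𝔸_{L⁺,∞} ≅ ℝ^{r₁} × ℂ^{r₂}` with all derivatives of order `≤ m` bounded by `A_φ′·H^{Re z′}` (integration by parts ⟹ polynomial Fourier decay ⟹ summable off the constant term).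
**`maassSelberg_flatSectionU_cm_two_final_of_archSmooth`**: ★ p858104 §1 with `hdec′` replaced by `χ, hχ, hf′, U₀, hU₀o, hU₀K, hφ′U, m, hm, A_φ′, hA_φ′, hφ′arch`; the three additive
Haar measures and four Borel structures B′ is parametrised by are CHOSEN INSIDE (they do not enter the statement).  For the spherical `φ′ ≡ φ₀′` every one of these but `hf′` is
discharged (★ p858035) — that is ★ p858104 §2; SAT-WITNESS for `U₀`: ★ p857911 `exists_level_binders_cm_two` (`U₀ := GL₂(𝒪̂_L)`), for `(ν, 𝓕)`: ★ p858104 `exists_unipotent_binders_cm_two`.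
HONEST LABEL: HC_CM is proved only modulo the 7 printed citations (2 remaining named inputs: hLiu418 = `stmt-HodgeConjecture-24832`, h413 = `stmt-HodgeConjecture-24833`) until rung 0
closes; this file asserts no named fact and closes no socket; `hφ′arch` for non-spherical `K`-finite `φ′` is K2E1-p08's (D5-b), not claimed here.
References: [MoeglinWaldspurger1995] I.2.10–I.2.13, II.1.5–II.1.7, IV.2.1–IV.2.3 · [Arthur1980TraceFormulaII] §4 · [Garrett2018] §2.9–§2.11, §11.3 · [Godement1964] §8.
-/

set_option autoImplicit false
-- the mandated namespace repeats the single-problem summit's segment (`HodgeConjecture.HodgeConjecture`)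
set_option linter.dupNamespace false

noncomputable section

open MeasureTheory Measure NumberField IsDedekindDomain Set MulAction Filter Topology Module
open scoped ENNReal NNReal ComplexConjugate Classical
open Literature.MeasureTheory.Group Literature.NumberTheory
open Literature.NumberTheory.Automorphic Literature.NumberTheory.Automorphic.UnitaryGroup AdelicGroupData
open NumberField.mixedEmbedding
open Summit.HodgeConjecture.HodgeConjecture.Cruxes.H413.K2E1BorelEisensteinU
open Summit.HodgeConjecture.HodgeConjecture.Cruxes.H413.K2E1MaassSelbergBracketsThree
open Summit.HodgeConjecture.HodgeConjecture.Cruxes.H413.K2E1BorelCosetsDictionary (forall_arithmeticBorel_iff)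
open Summit.HodgeConjecture.HodgeConjecture.Cruxes.H413.K2E1EisensteinMinusConstantTermBoundedLevelCMTwo (exists_bound_sub_borelConstantTerm_level_cm_two_of_archSmooth)
open Summit.HodgeConjecture.HodgeConjecture.Cruxes.H413.K2E1MaassSelbergCMTwoFinal (maassSelberg_flatSectionU_cm_two_final)

namespace Summit.HodgeConjecture.HodgeConjecture.Cruxes.H413.K2E1MaassSelbergCMTwoFinalArch

variable (L : Type) [Field L] [NumberField L] [IsCMField L]
  (hij : (((0 : Fin 2) : ℕ)) + 1 = ((1 : Fin 2) : ℕ)) (hN : 2 = 2 * ((0 : Fin 2) : ℕ) + 2)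
variable [MeasurableSpace (quasiSplit (↥(maximalRealSubfield L)) L (IsCMField.complexConj L) 2).Adelic] [BorelSpace (quasiSplit (↥(maximalRealSubfield L)) L (IsCMField.complexConj L) 2).Adelic]
variable [MeasurableSpace (AdeleRing (𝓞 L) L)ˣ] [BorelSpace (AdeleRing (𝓞 L) L)ˣ]

include hij hN in
/-- **THE MAASS–SELBERG RELATION FOR FLAT SECTIONS OF `U(J₂)` AT THE CM PAIR, `hdec′` DISCHARGED FROM `hφ′arch`** — ★ p858104 §1 ∘ ★ p857911 B′.  Hypotheses, in order: `μ, ν_G, μ_K, ν_I,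
𝓕_I`; a purely imaginary `δ ≠ 0` (the line chart `θ`); `ν`, `𝓕` (`ν 𝓕 = 1`, compact closure); `β`, `T ≥ 1`, continuous bounded left-`N(𝔸)`∕`B(L⁺)`-invariant `φ, φ′`, the sub-tube
`1 < Re z′ < Re z`; then IN PLACE OF `hdec′`: `χ` unitary, `hf′`, `U₀` open `≤ GL₂(𝒪̂_L)`, `hφ′U`, `m > [L⁺:ℚ]`, `A_φ′ ≥ 0`, `hφ′arch`; then `hψL1 hi₅ habs habs′ hΞ₁…hΞ₄`; conclusion verbatim
★ [D8]_two's (`hij`, `hN` are the two `rfl` side conditions of the line chart). [cite: MoeglinWaldspurger1995, I.2.10–I.2.13, II.1.7 and IV.2.1–IV.2.3] [cite: Garrett2018, §2.9–§2.11 and §11.3] -/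
theorem maassSelberg_flatSectionU_cm_two_final_of_archSmooth
    (μ : Measure (quasiSplit (↥(maximalRealSubfield L)) L (IsCMField.complexConj L) 2).automorphicQuotient) [(quasiSplit (↥(maximalRealSubfield L)) L (IsCMField.complexConj L) 2).IsAutomorphicMeasure μ]
    (νG : Measure (quasiSplit (↥(maximalRealSubfield L)) L (IsCMField.complexConj L) 2).Adelic) [νG.IsHaarMeasure] [νG.IsInvInvariant]
    (μK : Measure ((standardMaximalCompactGL 2 L).comap (adelicVal (↥(maximalRealSubfield L)) L (IsCMField.complexConj L) 2 ((StdForm.antidiagonal 2).over L)) : Subgroup (quasiSplit (↥(maximalRealSubfield L)) L (IsCMField.complexConj L) 2).Adelic))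
    [μK.IsHaarMeasure]
    (νI : Measure (AdeleRing (𝓞 L) L)ˣ) [νI.IsHaarMeasure]
    {𝓕I : Set (AdeleRing (𝓞 L) L)ˣ} (h𝓕I : IsIdeleClassDomain L 𝓕I)
    {δ : L} (hcδ : IsCMField.complexConj L δ = -δ) (hδ : δ ≠ 0)
    (ν : Measure ↥(adelicUnipotent (↥(maximalRealSubfield L)) L (IsCMField.complexConj L) 2)) [ν.IsHaarMeasure]
    {𝓕 : Set ↥(adelicUnipotent (↥(maximalRealSubfield L)) L (IsCMField.complexConj L) 2)} (h𝓕N : IsFundamentalDomain ↥(rationalUnipotent (↥(maximalRealSubfield L)) L (IsCMField.complexConj L) 2) 𝓕 ν) (h𝓕1 : ν 𝓕 = 1)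
    (h𝓕c : IsCompact (closure 𝓕)) :
    ∃ cμ K : ℝ, 0 < cμ ∧ 0 < K ∧
      ∀ {β : (quasiSplit (↥(maximalRealSubfield L)) L (IsCMField.complexConj L) 2).Adelic → ℝ≥0∞}, IsCoveringWeight ((arithmeticBorel (↥(maximalRealSubfield L)) L (IsCMField.complexConj L) 2).map (quasiSplit (↥(maximalRealSubfield L)) L (IsCMField.complexConj L) 2).arithmeticSubgroup.subtype) β →
      ∀ {T : ℝ≥0}, 1 ≤ T →
      ∀ {φ φ' : (quasiSplit (↥(maximalRealSubfield L)) L (IsCMField.complexConj L) 2).Adelic → ℂ},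
      Continuous φ →
        (∀ (n : unipotentInBorel (↥(maximalRealSubfield L)) L (IsCMField.complexConj L) 2) (y : (quasiSplit (↥(maximalRealSubfield L)) L (IsCMField.complexConj L) 2).Adelic), φ (((n : borelAdelic (↥(maximalRealSubfield L)) L (IsCMField.complexConj L) 2) : (quasiSplit (↥(maximalRealSubfield L)) L (IsCMField.complexConj L) 2).Adelic) * y) = φ y) →
        (∀ b ∈ arithmeticBorel (↥(maximalRealSubfield L)) L (IsCMField.complexConj L) 2, ∀ y : (quasiSplit (↥(maximalRealSubfield L)) L (IsCMField.complexConj L) 2).Adelic, φ ((b : (quasiSplit (↥(maximalRealSubfield L)) L (IsCMField.complexConj L) 2).Adelic) * y) = φ y) →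
      ∀ {Cφ : ℝ}, (∀ x, ‖φ x‖ ≤ Cφ) →
      Continuous φ' →
        (∀ (n : unipotentInBorel (↥(maximalRealSubfield L)) L (IsCMField.complexConj L) 2) (y : (quasiSplit (↥(maximalRealSubfield L)) L (IsCMField.complexConj L) 2).Adelic), φ' (((n : borelAdelic (↥(maximalRealSubfield L)) L (IsCMField.complexConj L) 2) : (quasiSplit (↥(maximalRealSubfield L)) L (IsCMField.complexConj L) 2).Adelic) * y) = φ' y) →
        (∀ b ∈ arithmeticBorel (↥(maximalRealSubfield L)) L (IsCMField.complexConj L) 2, ∀ y : (quasiSplit (↥(maximalRealSubfield L)) L (IsCMField.complexConj L) 2).Adelic, φ' ((b : (quasiSplit (↥(maximalRealSubfield L)) L (IsCMField.complexConj L) 2).Adelic) * y) = φ' y) →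
      ∀ {Cφ' : ℝ}, (∀ x, ‖φ' x‖ ≤ Cφ') →
      ∀ {z z' : ℂ}, 1 < z'.re → z'.re < z.re →
      -- `hdec′` DISCHARGED by ★ p857911 B′ `exists_bound_sub_borelConstantTerm_level_cm_two_of_archSmooth` from: the modularity `hf′` of `f′_{z′}` under `B(𝔸)` (unitary Hecke character `χ`), an open finite
      -- level `U₀ ≤ GL₂(𝒪̂_L)` fixing `φ′` on the right, `m > [L⁺:ℚ]`, and the archimedean binder `hφ′arch` along the big-cell line `t ↦ ι(w₀)·n(θ t)·k` (envelope `A_φ′·H^{Re z′}`, `A_φ′ ≥ 0`)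
        ∀ (χ : GaloisRepresentations.HeckeCharacter L), χ.IsUnitary →
        (∀ (b g : (quasiSplit (↥(maximalRealSubfield L)) L (IsCMField.complexConj L) 2).Adelic) (u : (AdeleRing (𝓞 L) L)ˣ),
          ((b.1 : GL (Fin 2) (AdeleRing (𝓞 L) L)) : Matrix (Fin 2) (Fin 2) (AdeleRing (𝓞 L) L)) 1 0 = 0 →
          (u : (AdeleRing (𝓞 L) L)) = ((b.1 : GL (Fin 2) (AdeleRing (𝓞 L) L)) : Matrix (Fin 2) (Fin 2) (AdeleRing (𝓞 L) L)) 0 0 →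
            flatSectionU φ' z' (b * g) = ((χ u : ℂˣ) : ℂ) * ((GaloisRepresentations.ideleNorm u : ℝ) : ℂ) ^ z' * flatSectionU φ' z' g) →
        ∀ {U₀ : Subgroup (GL (Fin 2) (FiniteAdeleRing (𝓞 L) L))}, IsOpen (U₀ : Set (GL (Fin 2) (FiniteAdeleRing (𝓞 L) L))) → U₀ ≤ glFiniteIntegralLevel 2 L →
        (∀ u : (quasiSplit (↥(maximalRealSubfield L)) L (IsCMField.complexConj L) 2).Adelic, adelicVal ↥(maximalRealSubfield L) L (IsCMField.complexConj L) 2 ((StdForm.antidiagonal 2).over L) u ∈ U₀.map (GLn.ofFinite 2 L) → ∀ y : (quasiSplit (↥(maximalRealSubfield L)) L (IsCMField.complexConj L) 2).Adelic, φ' (y * u) = φ' y) →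
        ∀ {m : ℕ}, (finrank ℚ ↥(maximalRealSubfield L) : ℝ) < m → ∀ {Aφ' : ℝ}, 0 ≤ Aφ' →
        (∀ k ∈ ((standardMaximalCompactGL 2 L).comap (adelicVal ↥(maximalRealSubfield L) L (IsCMField.complexConj L) 2 ((StdForm.antidiagonal 2).over L)) : Subgroup (quasiSplit (↥(maximalRealSubfield L)) L (IsCMField.complexConj L) 2).Adelic), ∀ b : FiniteAdeleRing (𝓞 ↥(maximalRealSubfield L)) ↥(maximalRealSubfield L),
          ContDiff ℝ m ((fun a : InfiniteAdeleRing ↥(maximalRealSubfield L) => flatSectionU φ' z' (((quasiSplit (↥(maximalRealSubfield L)) L (IsCMField.complexConj L) 2).toAdelic (weylLongU ((IsCMField.complexConj L : L ≃ₐ[↥(maximalRealSubfield L)] L) : L →+* L) (rfl : ((StdForm.antidiagonal 2).over L) = ((StdForm.antidiagonal 2).over L)))) *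
              ((middleRootUnipotent hij hN (Multiplicative.ofAdd (traceZeroLine ↥(maximalRealSubfield L) L (IsCMField.complexConj L) hcδ hδ ((a, b) : AdeleRing (𝓞 ↥(maximalRealSubfield L)) ↥(maximalRealSubfield L)))) : ↥(adelicUnipotent ↥(maximalRealSubfield L) L (IsCMField.complexConj L) 2)) : (quasiSplit (↥(maximalRealSubfield L)) L (IsCMField.complexConj L) 2).Adelic) * k)) ∘ (InfiniteAdeleRing.ringEquiv_mixedSpace ↥(maximalRealSubfield L)).symm) ∧
          ∀ j : ℕ, j ≤ m → ∀ s : mixedSpace ↥(maximalRealSubfield L),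
            ‖iteratedFDeriv ℝ j ((fun a : InfiniteAdeleRing ↥(maximalRealSubfield L) => flatSectionU φ' z' (((quasiSplit (↥(maximalRealSubfield L)) L (IsCMField.complexConj L) 2).toAdelic (weylLongU ((IsCMField.complexConj L : L ≃ₐ[↥(maximalRealSubfield L)] L) : L →+* L) (rfl : ((StdForm.antidiagonal 2).over L) = ((StdForm.antidiagonal 2).over L)))) *
              ((middleRootUnipotent hij hN (Multiplicative.ofAdd (traceZeroLine ↥(maximalRealSubfield L) L (IsCMField.complexConj L) hcδ hδ ((a, b) : AdeleRing (𝓞 ↥(maximalRealSubfield L)) ↥(maximalRealSubfield L)))) : ↥(adelicUnipotent ↥(maximalRealSubfield L) L (IsCMField.complexConj L) 2)) : (quasiSplit (↥(maximalRealSubfield L)) L (IsCMField.complexConj L) 2).Adelic) * k)) ∘ (InfiniteAdeleRing.ringEquiv_mixedSpace ↥(maximalRealSubfield L)).symm) s‖ ≤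
              Aφ' * (borelHeight (((quasiSplit (↥(maximalRealSubfield L)) L (IsCMField.complexConj L) 2).toAdelic (weylLongU ((IsCMField.complexConj L : L ≃ₐ[↥(maximalRealSubfield L)] L) : L →+* L) (rfl : ((StdForm.antidiagonal 2).over L) = ((StdForm.antidiagonal 2).over L)))) *
              ((middleRootUnipotent hij hN (Multiplicative.ofAdd (traceZeroLine ↥(maximalRealSubfield L) L (IsCMField.complexConj L) hcδ hδ (((InfiniteAdeleRing.ringEquiv_mixedSpace ↥(maximalRealSubfield L)).symm s, b) : AdeleRing (𝓞 ↥(maximalRealSubfield L)) ↥(maximalRealSubfield L)))) : ↥(adelicUnipotent ↥(maximalRealSubfield L) L (IsCMField.complexConj L) 2)) : (quasiSplit (↥(maximalRealSubfield L)) L (IsCMField.complexConj L) 2).Adelic) * k) : ℝ) ^ z'.re) →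
        ∫⁻ g, β g * ‖({y : (quasiSplit (↥(maximalRealSubfield L)) L (IsCMField.complexConj L) 2).Adelic | borelHeight y ≤ T}.indicator (flatSectionU φ z) g - {y : (quasiSplit (↥(maximalRealSubfield L)) L (IsCMField.complexConj L) 2).Adelic | T < borelHeight y}.indicator (flatSectionU (fun g : (quasiSplit (↥(maximalRealSubfield L)) L (IsCMField.complexConj L) 2).Adelic => (∫ v : ↥(adelicUnipotent (↥(maximalRealSubfield L)) L (IsCMField.complexConj L) 2), flatSectionU φ z ((quasiSplit (↥(maximalRealSubfield L)) L (IsCMField.complexConj L) 2).toAdelic (weylLongU ((IsCMField.complexConj L : L ≃ₐ[↥(maximalRealSubfield L)] L) : L →+* L) (rfl : (StdForm.antidiagonal 2).over L = (StdForm.antidiagonal 2).over L)) * ((v : (quasiSplit (↥(maximalRealSubfield L)) L (IsCMField.complexConj L) 2).Adelic) * g)) ∂ν) * ((borelHeight g : ℝ) : ℂ) ^ (z - 1)) (1 - z)) g)‖ₑ ∂νG < ∞ →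
        Integrable (fun g => (β g).toReal • (({y : (quasiSplit (↥(maximalRealSubfield L)) L (IsCMField.complexConj L) 2).Adelic | borelHeight y ≤ T}.indicator (flatSectionU φ z) g - {y : (quasiSplit (↥(maximalRealSubfield L)) L (IsCMField.complexConj L) 2).Adelic | T < borelHeight y}.indicator (flatSectionU (fun g : (quasiSplit (↥(maximalRealSubfield L)) L (IsCMField.complexConj L) 2).Adelic => (∫ v : ↥(adelicUnipotent (↥(maximalRealSubfield L)) L (IsCMField.complexConj L) 2), flatSectionU φ z ((quasiSplit (↥(maximalRealSubfield L)) L (IsCMField.complexConj L) 2).toAdelic (weylLongU ((IsCMField.complexConj L : L ≃ₐ[↥(maximalRealSubfield L)] L) : L →+* L) (rfl : (StdForm.antidiagonal 2).over L = (StdForm.antidiagonal 2).over L)) * ((v : (quasiSplit (↥(maximalRealSubfield L)) L (IsCMField.complexConj L) 2).Adelic) * g)) ∂ν) * ((borelHeight g : ℝ) : ℂ) ^ (z - 1)) (1 - z)) g) * conj (∫ u : ↥(adelicUnipotent (↥(maximalRealSubfield L)) L (IsCMField.complexConj L) 2), {y : (quasiSplit (↥(maximalRealSubfield L)) L (IsCMField.complexConj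 L) 2).Adelic | T < borelHeight y}.indicator (flatSectionU φ' z' + flatSectionU (fun g : (quasiSplit (↥(maximalRealSubfield L)) L (IsCMField.complexConj L) 2).Adelic => (∫ v : ↥(adelicUnipotent (↥(maximalRealSubfield L)) L (IsCMField.complexConj L) 2), flatSectionU φ' z' ((quasiSplit (↥(maximalRealSubfield L)) L (IsCMField.complexConj L) 2).toAdelic (weylLongU ((IsCMField.complexConj L : L ≃ₐ[↥(maximalRealSubfield L)] L) : L →+* L) (rfl : (StdForm.antidiagonal 2).over L = (StdForm.antidiagonal 2).over L)) * ((v : (quasiSplit (↥(maximalRealSubfield L)) L (IsCMField.complexConj L) 2).Adelic) * g)) ∂ν) * ((borelHeight g : ℝ) : ℂ) ^ (z' - 1)) (1 - z')) ((quasiSplit (↥(maximalRealSubfield L)) L (IsCMField.complexConj L) 2).toAdelic (weylLongU ((IsCMField.complexConj L : L ≃ₐ[↥(maximalRealSubfield L)] L) : L →+* L) (rfl : (StdForm.antidiagonal 2).over L = (StdForm.antidiagonal 2).over L)) * ((u : (quasiSplit (↥(maximalRealSubfield L)) L (IsCMField.complexConj L) 2).Adelic) * g)) ∂ν))) νG 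→
        ∫⁻ g, β g * ∫⁻ u : ↥(adelicUnipotent (↥(maximalRealSubfield L)) L (IsCMField.complexConj L) 2), ‖{y : (quasiSplit (↥(maximalRealSubfield L)) L (IsCMField.complexConj L) 2).Adelic | T < borelHeight y}.indicator (flatSectionU φ' z' + flatSectionU (fun g : (quasiSplit (↥(maximalRealSubfield L)) L (IsCMField.complexConj L) 2).Adelic => (∫ v : ↥(adelicUnipotent (↥(maximalRealSubfield L)) L (IsCMField.complexConj L) 2), flatSectionU φ' z' ((quasiSplit (↥(maximalRealSubfield L)) L (IsCMField.complexConj L) 2).toAdelic (weylLongU ((IsCMField.complexConj L : L ≃ₐ[↥(maximalRealSubfield L)] L) : L →+* L) (rfl : (StdForm.antidiagonal 2).over L = (StdForm.antidiagonal 2).over L)) * ((v : (quasiSplit (↥(maximalRealSubfield L)) L (IsCMField.complexConj L) 2).Adelic) * g)) ∂ν) * ((borelHeight g : ℝ) : ℂ) ^ (z' - 1)) (1 - z')) ((quasiSplit (↥(maximalRealSubfield L)) L (IsCMField.complexConj L) 2).toAdelic (weylLongU ((IsCMField.complexConj L : L ≃ₐ[↥(maximalRealSubfield L)] L) : L →+*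 L) (rfl : (StdForm.antidiagonal 2).over L = (StdForm.antidiagonal 2).over L)) * ((u : (quasiSplit (↥(maximalRealSubfield L)) L (IsCMField.complexConj L) 2).Adelic) * g)) * conj ({y : (quasiSplit (↥(maximalRealSubfield L)) L (IsCMField.complexConj L) 2).Adelic | borelHeight y ≤ T}.indicator (flatSectionU φ z) g - {y : (quasiSplit (↥(maximalRealSubfield L)) L (IsCMField.complexConj L) 2).Adelic | T < borelHeight y}.indicator (flatSectionU (fun g : (quasiSplit (↥(maximalRealSubfield L)) L (IsCMField.complexConj L) 2).Adelic => (∫ v : ↥(adelicUnipotent (↥(maximalRealSubfield L)) L (IsCMField.complexConj L) 2), flatSectionU φ z ((quasiSplit (↥(maximalRealSubfield L)) L (IsCMField.complexConj L) 2).toAdelic (weylLongU ((IsCMField.complexConj L : L ≃ₐ[↥(maximalRealSubfield L)] L) : L →+* L) (rfl : (StdForm.antidiagonal 2).over L = (StdForm.antidiagonal 2).over L)) * ((v : (quasiSplit (↥(maximalRealSubfield L)) L (IsCMField.complexConj L) 2).Adelic) * g)) ∂ν) * ((borelHeight g : ℝ) : ℂ) ^ (z - 1)) (1 - z)) g)‖ₑ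 ∂ν ∂νG < ∞ →
        ∫⁻ g, β g * ∫⁻ u : ↥(adelicUnipotent (↥(maximalRealSubfield L)) L (IsCMField.complexConj L) 2), ‖{y : (quasiSplit (↥(maximalRealSubfield L)) L (IsCMField.complexConj L) 2).Adelic | T < borelHeight y}.indicator (flatSectionU φ' z' + flatSectionU (fun g : (quasiSplit (↥(maximalRealSubfield L)) L (IsCMField.complexConj L) 2).Adelic => (∫ v : ↥(adelicUnipotent (↥(maximalRealSubfield L)) L (IsCMField.complexConj L) 2), flatSectionU φ' z' ((quasiSplit (↥(maximalRealSubfield L)) L (IsCMField.complexConj L) 2).toAdelic (weylLongU ((IsCMField.complexConj L : L ≃ₐ[↥(maximalRealSubfield L)] L) : L →+* L) (rfl : (StdForm.antidiagonal 2).over L = (StdForm.antidiagonal 2).over L)) * ((v : (quasiSplit (↥(maximalRealSubfield L)) L (IsCMField.complexConj L) 2).Adelic) * g)) ∂ν) * ((borelHeight g : ℝ) : ℂ) ^ (z' - 1)) (1 - z')) g * conj ({y : (quasiSplit (↥(maximalRealSubfield L)) L (IsCMField.complexConj L) 2).Adelic | borelHeight y ≤ T}.indicator (flatSectionU φ z)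 (((quasiSplit (↥(maximalRealSubfield L)) L (IsCMField.complexConj L) 2).toAdelic (weylLongU ((IsCMField.complexConj L : L ≃ₐ[↥(maximalRealSubfield L)] L) : L →+* L) (rfl : (StdForm.antidiagonal 2).over L = (StdForm.antidiagonal 2).over L)))⁻¹ * ((u : (quasiSplit (↥(maximalRealSubfield L)) L (IsCMField.complexConj L) 2).Adelic) * g)) - {y : (quasiSplit (↥(maximalRealSubfield L)) L (IsCMField.complexConj L) 2).Adelic | T < borelHeight y}.indicator (flatSectionU (fun g : (quasiSplit (↥(maximalRealSubfield L)) L (IsCMField.complexConj L) 2).Adelic => (∫ v : ↥(adelicUnipotent (↥(maximalRealSubfield L)) L (IsCMField.complexConj L) 2), flatSectionU φ z ((quasiSplit (↥(maximalRealSubfield L)) L (IsCMField.complexConj L) 2).toAdelic (weylLongU ((IsCMField.complexConj L : L ≃ₐ[↥(maximalRealSubfield L)] L) : L →+* L) (rfl : (StdForm.antidiagonal 2).over L = (StdForm.antidiagonal 2).over L)) * ((v : (quasiSplit (↥(maximalRealSubfield L)) L (IsCMField.complexConj L) 2).Adelic) * g)) ∂ν) * ((borelHeight g : ℝ) : ℂ)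 ^ (z - 1)) (1 - z)) (((quasiSplit (↥(maximalRealSubfield L)) L (IsCMField.complexConj L) 2).toAdelic (weylLongU ((IsCMField.complexConj L : L ≃ₐ[↥(maximalRealSubfield L)] L) : L →+* L) (rfl : (StdForm.antidiagonal 2).over L = (StdForm.antidiagonal 2).over L)))⁻¹ * ((u : (quasiSplit (↥(maximalRealSubfield L)) L (IsCMField.complexConj L) 2).Adelic) * g)))‖ₑ ∂ν ∂νG < ∞ →
      ∀ {Ξ₁ Ξ₂ Ξ₃ Ξ₄ : (AdeleRing (𝓞 L) L)ˣ → ℂ},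
      Measurable Ξ₁ → ∀ {CΞ₁ : ℝ}, (∀ x, ‖Ξ₁ x‖ ≤ CΞ₁) → (∀ k ∈ GaloisRepresentations.principalIdeles L, ∀ x, Ξ₁ (k * x) = Ξ₁ x) →
        (∀ (r : ℝ≥0ˣ) (x : (AdeleRing (𝓞 L) L)ˣ), Ξ₁ (posRealIdele L r * x) = Ξ₁ x) →
        (∀ t : torusInBorel (↥(maximalRealSubfield L)) L (IsCMField.complexConj L) 2,
          ∫ k, φ (((t : borelAdelic (↥(maximalRealSubfield L)) L (IsCMField.complexConj L) 2) : (quasiSplit (↥(maximalRealSubfield L)) L (IsCMField.complexConj L) 2).Adelic) * (k : (quasiSplit (↥(maximalRealSubfield L)) L (IsCMField.complexConj L) 2).Adelic)) *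
              conj (φ' (((t : borelAdelic (↥(maximalRealSubfield L)) L (IsCMField.complexConj L) 2) : (quasiSplit (↥(maximalRealSubfield L)) L (IsCMField.complexConj L) 2).Adelic) * (k : (quasiSplit (↥(maximalRealSubfield L)) L (IsCMField.complexConj L) 2).Adelic))) ∂μK = Ξ₁ (diagUnit (t : borelAdelic (↥(maximalRealSubfield L)) L (IsCMField.complexConj L) 2).2 0)) →
      Measurable Ξ₂ → ∀ {CΞ₂ : ℝ}, (∀ x, ‖Ξ₂ x‖ ≤ CΞ₂) → (∀ k ∈ GaloisRepresentations.principalIdeles L, ∀ x, Ξ₂ (k * x) = Ξ₂ x) →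
        (∀ (r : ℝ≥0ˣ) (x : (AdeleRing (𝓞 L) L)ˣ), Ξ₂ (posRealIdele L r * x) = Ξ₂ x) →
        (∀ t : torusInBorel (↥(maximalRealSubfield L)) L (IsCMField.complexConj L) 2,
          ∫ k, φ (((t : borelAdelic (↥(maximalRealSubfield L)) L (IsCMField.complexConj L) 2) : (quasiSplit (↥(maximalRealSubfield L)) L (IsCMField.complexConj L) 2).Adelic) * (k : (quasiSplit (↥(maximalRealSubfield L)) L (IsCMField.complexConj L) 2).Adelic)) *
              conj ((fun g : (quasiSplit (↥(maximalRealSubfield L)) L (IsCMField.complexConj L) 2).Adelic => (∫ v : ↥(adelicUnipotent (↥(maximalRealSubfield L)) L (IsCMField.complexConj L) 2), flatSectionU φ' z' ((quasiSplit (↥(maximalRealSubfield L)) L (IsCMField.complexConj L) 2).toAdelic (weylLongU ((IsCMField.complexConj L : L ≃ₐ[↥(maximalRealSubfield L)] L) : L →+* L) (rfl : (StdForm.antidiagonal 2).over L = (StdForm.antidiagonal 2).over L)) * ((v : (quasiSplit (↥(maximalRealSubfield L)) L (IsCMField.complexConj L) 2).Adelic) * g)) ∂ν) * ((borelHeight g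 : ℝ) : ℂ) ^ (z' - 1)) (((t : borelAdelic (↥(maximalRealSubfield L)) L (IsCMField.complexConj L) 2) : (quasiSplit (↥(maximalRealSubfield L)) L (IsCMField.complexConj L) 2).Adelic) * (k : (quasiSplit (↥(maximalRealSubfield L)) L (IsCMField.complexConj L) 2).Adelic))) ∂μK = Ξ₂ (diagUnit (t : borelAdelic (↥(maximalRealSubfield L)) L (IsCMField.complexConj L) 2).2 0)) →
      Measurable Ξ₃ → ∀ {CΞ₃ : ℝ}, (∀ x, ‖Ξ₃ x‖ ≤ CΞ₃) → (∀ k ∈ GaloisRepresentations.principalIdeles L, ∀ x, Ξ₃ (k * x) = Ξ₃ x) →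
        (∀ (r : ℝ≥0ˣ) (x : (AdeleRing (𝓞 L) L)ˣ), Ξ₃ (posRealIdele L r * x) = Ξ₃ x) →
        (∀ t : torusInBorel (↥(maximalRealSubfield L)) L (IsCMField.complexConj L) 2,
          ∫ k, (fun g : (quasiSplit (↥(maximalRealSubfield L)) L (IsCMField.complexConj L) 2).Adelic => (∫ v : ↥(adelicUnipotent (↥(maximalRealSubfield L)) L (IsCMField.complexConj L) 2), flatSectionU φ z ((quasiSplit (↥(maximalRealSubfield L)) L (IsCMField.complexConj L) 2).toAdelic (weylLongU ((IsCMField.complexConj L : L ≃ₐ[↥(maximalRealSubfield L)] L) : L →+* L) (rfl : (StdForm.antidiagonal 2).over L = (StdForm.antidiagonal 2).over L)) * ((v : (quasiSplit (↥(maximalRealSubfield L)) L (IsCMField.complexConj L) 2).Adelic) * g)) ∂ν) * ((borelHeight g : ℝ) : ℂ) ^ (z - 1)) (((t : borelAdelic (↥(maximalRealSubfield L)) L (IsCMField.complexConj L) 2) : (quasiSplit (↥(maximalRealSubfield L)) L (IsCMField.complexConj L) 2).Adelic) * (k : (quasiSplit (↥(maximalRealSubfield L)) L (IsCMField.complexConj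 L) 2).Adelic)) *
              conj (φ' (((t : borelAdelic (↥(maximalRealSubfield L)) L (IsCMField.complexConj L) 2) : (quasiSplit (↥(maximalRealSubfield L)) L (IsCMField.complexConj L) 2).Adelic) * (k : (quasiSplit (↥(maximalRealSubfield L)) L (IsCMField.complexConj L) 2).Adelic))) ∂μK = Ξ₃ (diagUnit (t : borelAdelic (↥(maximalRealSubfield L)) L (IsCMField.complexConj L) 2).2 0)) →
      Measurable Ξ₄ → ∀ {CΞ₄ : ℝ}, (∀ x, ‖Ξ₄ x‖ ≤ CΞ₄) → (∀ k ∈ GaloisRepresentations.principalIdeles L, ∀ x, Ξ₄ (k * x) = Ξ₄ x) →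
        (∀ (r : ℝ≥0ˣ) (x : (AdeleRing (𝓞 L) L)ˣ), Ξ₄ (posRealIdele L r * x) = Ξ₄ x) →
        (∀ t : torusInBorel (↥(maximalRealSubfield L)) L (IsCMField.complexConj L) 2,
          ∫ k, (fun g : (quasiSplit (↥(maximalRealSubfield L)) L (IsCMField.complexConj L) 2).Adelic => (∫ v : ↥(adelicUnipotent (↥(maximalRealSubfield L)) L (IsCMField.complexConj L) 2), flatSectionU φ z ((quasiSplit (↥(maximalRealSubfield L)) L (IsCMField.complexConj L) 2).toAdelic (weylLongU ((IsCMField.complexConj L : L ≃ₐ[↥(maximalRealSubfield L)] L) : L →+* L) (rfl : (StdForm.antidiagonal 2).over L = (StdForm.antidiagonal 2).over L)) * ((v : (quasiSplit (↥(maximalRealSubfield L)) L (IsCMField.complexConj L) 2).Adelic) * g)) ∂ν) * ((borelHeight g : ℝ) : ℂ) ^ (z - 1)) (((t : borelAdelic (↥(maximalRealSubfield L)) L (IsCMField.complexConj L) 2) : (quasiSplit (↥(maximalRealSubfield L)) L (IsCMField.complexConj L) 2).Adelic) * (k : (quasiSplit (↥(maximalRealSubfield L)) L (IsCMField.complexConj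 L) 2).Adelic)) *
              conj ((fun g : (quasiSplit (↥(maximalRealSubfield L)) L (IsCMField.complexConj L) 2).Adelic => (∫ v : ↥(adelicUnipotent (↥(maximalRealSubfield L)) L (IsCMField.complexConj L) 2), flatSectionU φ' z' ((quasiSplit (↥(maximalRealSubfield L)) L (IsCMField.complexConj L) 2).toAdelic (weylLongU ((IsCMField.complexConj L : L ≃ₐ[↥(maximalRealSubfield L)] L) : L →+* L) (rfl : (StdForm.antidiagonal 2).over L = (StdForm.antidiagonal 2).over L)) * ((v : (quasiSplit (↥(maximalRealSubfield L)) L (IsCMField.complexConj L) 2).Adelic) * g)) ∂ν) * ((borelHeight g : ℝ) : ℂ) ^ (z' - 1)) (((t : borelAdelic (↥(maximalRealSubfield L)) L (IsCMField.complexConj L) 2) : (quasiSplit (↥(maximalRealSubfield L)) L (IsCMField.complexConj L) 2).Adelic) * (k : (quasiSplit (↥(maximalRealSubfield L)) L (IsCMField.complexConj L) 2).Adelic))) ∂μK = Ξ₄ (diagUnit (t : borelAdelic (↥(maximalRealSubfield L)) L (IsCMField.complexConj L) 2).2 0)) →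
        ∫ x, (quasiSplit (↥(maximalRealSubfield L)) L (IsCMField.complexConj L) 2).quotFun (truncation ν 𝓕 T (eisensteinSeriesU (flatSectionU φ z))) x * conj ((quasiSplit (↥(maximalRealSubfield L)) L (IsCMField.complexConj L) 2).quotFun (truncation ν 𝓕 T (eisensteinSeriesU (flatSectionU φ' z'))) x) ∂μ =
          (cμ : ℂ) * ((K : ℂ) *
            ((((T : ℝ) : ℂ) ^ (z + conj z' - 1) / (z + conj z' - 1)) * (∫ x in {x : (AdeleRing (𝓞 L) L)ˣ | (IdeleClassGroup.ideleNorm L x : ℝ) ≤ 1} ∩ 𝓕I, ((IdeleClassGroup.ideleNorm L x : ℝ) : ℂ) * Ξ₁ x ∂νI)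
              + (((T : ℝ) : ℂ) ^ (z - conj z') / (z - conj z')) * (∫ x in {x : (AdeleRing (𝓞 L) L)ˣ | (IdeleClassGroup.ideleNorm L x : ℝ) ≤ 1} ∩ 𝓕I, ((IdeleClassGroup.ideleNorm L x : ℝ) : ℂ) * Ξ₂ x ∂νI)
              - (((T : ℝ) : ℂ) ^ (-(z - conj z')) / (z - conj z')) * (∫ x in {x : (AdeleRing (𝓞 L) L)ˣ | (IdeleClassGroup.ideleNorm L x : ℝ) ≤ 1} ∩ 𝓕I, ((IdeleClassGroup.ideleNorm L x : ℝ) : ℂ) * Ξ₃ x ∂νI)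
              - (((T : ℝ) : ℂ) ^ (-(z + conj z' - 1)) / (z + conj z' - 1)) * (∫ x in {x : (AdeleRing (𝓞 L) L)ˣ | (IdeleClassGroup.ideleNorm L x : ℝ) ≤ 1} ∩ 𝓕I, ((IdeleClassGroup.ideleNorm L x : ℝ) : ℂ) * Ξ₄ x ∂νI))) := by
  obtain ⟨cμ, K, hcμ, hK, h⟩ := maassSelberg_flatSectionU_cm_two_final L μ νG μK νI h𝓕I ν h𝓕N h𝓕1 h𝓕c
  refine ⟨cμ, K, hcμ, hK, ?_⟩
  intro β hβ T hT φ φ' hφc hφN hφB Cφ hφC hφ'c hφ'N hφ'B Cφ' hφ'C z z' hz' hzz' χ hχ hf' U₀ hU₀o hU₀K hφ'U m hm Aφ' hAφ' hφ'arch hψL1 hi₅ habs habs'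
    Ξ₁ Ξ₂ Ξ₃ Ξ₄ hΞ₁m CΞ₁ hΞ₁C hΞ₁K hΞ₁M hΞ₁ hΞ₂m CΞ₂ hΞ₂C hΞ₂K hΞ₂M hΞ₂ hΞ₃m CΞ₃ hΞ₃C hΞ₃K hΞ₃M hΞ₃ hΞ₄m CΞ₄ hΞ₄C hΞ₄K hΞ₄M hΞ₄
  -- B′'s auxiliary data: Borel structures and additive Haar measures of `𝔸_L`, `𝔸_{L⁺}`, `𝔸_{L⁺,∞}`, `𝔸_{L⁺,f}` (not in the statement)
  letI : MeasurableSpace (AdeleRing (𝓞 L) L) := borel _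
  haveI : BorelSpace (AdeleRing (𝓞 L) L) := ⟨rfl⟩
  letI : MeasurableSpace (AdeleRing (𝓞 ↥(maximalRealSubfield L)) ↥(maximalRealSubfield L)) := borel _
  haveI : BorelSpace (AdeleRing (𝓞 ↥(maximalRealSubfield L)) ↥(maximalRealSubfield L)) := ⟨rfl⟩
  letI : MeasurableSpace (InfiniteAdeleRing ↥(maximalRealSubfield L)) := borel _
  haveI : BorelSpace (InfiniteAdeleRing ↥(maximalRealSubfield L)) := ⟨rfl⟩
  letI : MeasurableSpace (FiniteAdeleRing (𝓞 ↥(maximalRealSubfield L)) ↥(maximalRealSubfield L)) := borel _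
  haveI : BorelSpace (FiniteAdeleRing (𝓞 ↥(maximalRealSubfield L)) ↥(maximalRealSubfield L)) := ⟨rfl⟩
  haveI := locallyCompactSpace_adeleRing' ↥(maximalRealSubfield L)
  haveI := locallyCompactSpace_finiteAdeleRing' ↥(maximalRealSubfield L)
  obtain ⟨M₁, hdec'⟩ := exists_bound_sub_borelConstantTerm_level_cm_two_of_archSmooth L hij hN hcδ hδ ν h𝓕N h𝓕c
    (Measure.addHaar : Measure (AdeleRing (𝓞 ↥(maximalRealSubfield L)) ↥(maximalRealSubfield L))) (Measure.addHaar : Measure (InfiniteAdeleRing ↥(maximalRealSubfield L)))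
    (Measure.addHaar : Measure (FiniteAdeleRing (𝓞 ↥(maximalRealSubfield L)) ↥(maximalRealSubfield L))) χ hχ hz' hφ'c hφ'C (forall_arithmeticBorel_iff.1 hφ'B) hf'
    hU₀o hU₀K hφ'U hT hm hAφ' hφ'arch
  exact h hβ hT hφc hφN hφB hφC hφ'c hφ'N hφ'B hφ'C hz' hzz' hdec' hψL1 hi₅ habs habs'
    hΞ₁m hΞ₁C hΞ₁K hΞ₁M hΞ₁ hΞ₂m hΞ₂C hΞ₂K hΞ₂M hΞ₂ hΞ₃m hΞ₃C hΞ₃K hΞ₃M hΞ₃ hΞ₄m hΞ₄C hΞ₄K hΞ₄M hΞ₄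

end Summit.HodgeConjecture.HodgeConjecture.Cruxes.H413.K2E1MaassSelbergCMTwoFinalArch

end
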